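import Literature.Combinatorics.Designs.OrthogonalDesigns
import Literature.Combinatorics.Designs.TMatrixRows

/-!
# The Cooper–J. Wallis theorem: T-matrices give a Baumert–Hall array `OD(4t; t, t, t, t)`, hence with
# Williamson-type matrices of order `w` a Hadamard matrix of order `4tw`

[Seberry–Yamada, *Hadamard Matrices* (Wiley 2020)] (`SeberryYamada2020`) Theorem 3.11 (Cooper and J. Wallis,
[Bull. Austral. Math. Soc. 7 (1972) 269–277] `CooperWallis1972`): let `X₁, …, X₄` be circulant (or type one) T-matrices
of order `n` and `a, b, c, d` commuting variables; then
`A = aX₁ + bX₂ + cX₃ + dX₄`, `B = -bX₁ + aX₂ + dX₃ - cX₄`, `C = -cX₁ - dX₂ + aX₃ + bX₄`, `D = -dX₁ + cX₂ - bX₃ + aX₄`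
in the Goethals–Seidel array give an `OD(4n; n, n, n, n)` (a Baumert–Hall array of order `n`, Corollary 3.5 /
Theorem 3.10 (ii)–(iii)) and a Hadamard matrix of order `4n`; Corollary 3.6: with Williamson(-type) matrices of order
`w`, a Hadamard matrix of order `4tw`.  The case `a = b = c = d = 1` (order `4n`) is `TMatrixRows.tmatrixRows_isHadamard`;
this file proves the GENERAL form (the `TODO(general form)` of `TSequences.lean`):
* `gsMatrix_apply_table` — every entry of the Goethals–Seidel array is `±` one entry of one of the four first rows, with a
  position-independent sign/row/argument table (so the array is linear in the rows and inherits "one non-zero per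
  position");
* `cwRowX`, `sum_cwRowX_mul`, `gram_cwRowX`, `cwMatrixX_mul_transpose` — with integer weights `x = (a, b, c, d)` the
  four rows `R_p = Σ_k ε_{pk} x_{p ⊕ k} t_k` satisfy `Σ_p R_p(i) R_p(j) = (Σ x_v²) Σ_k t_k(i) t_k(j)` (orthogonality of the
  `OD(4; 1,1,1,1)` pattern), hence for T-matrix rows the array `M(x)` has `M(x) M(x)ᵀ = (a²+b²+c²+d²) n I`
  (Theorem 3.11 for every integer substitution);
* `cwCoef`, `cwMatrixX_eq_sum`, `cwCoef_isBHArray` — the four coefficient matrices `P_v = M(e_v)` form a Baumert–Hall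
  array `BH(4n; n,n,n,n)` (Gram identities by polarisation `x = e_v, e_v + e_w`; one non-zero per position from the
  table and the T-matrix property) [Cor 3.5]; `cwDesign_mul_transpose` — the design identity for `a, b, c, d` in ANY
  commutative ring (Theorem 3.11 as printed, via `IsOD.subst_mul_transpose`);
* `hadamard_of_tmatrixRows_williamsonType`, `exists_hadamard_of_tmatrixRows_williamsonType`, `…_of_tseq_…` —
  Corollary 3.6: T-matrices (or T-sequences) of order `n` and Williamson-type matrices of order `w` give a Hadamard
  matrix of order `4nw`.
Cell pub-namedobj (venture DiscreteObjects), target H (HANDOFF-H-g24 item 4).  No `sorry`, no new axioms.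
-/

open Matrix BigOperators Finset
open scoped Kronecker

namespace Literature.Combinatorics.Designs.CooperWallis

open Literature.Combinatorics.Designs.LegendrePairs (PAF IsPM)
open Literature.Combinatorics.Designs.GoethalsSeidel (gsMatrix gsBlocks bcirc bcircT circT IsHadamardMatrix
  gsMatrix_mul_transpose circulant_mul_circT_apply bcirc_apply bcircT_apply)
open Literature.Combinatorics.Designs.TSequences (cwSign cwSign_pm IsTSeq periodize)
open Literature.Combinatorics.Designs.TMatrices (IsTMatrixRows cwRowZ tseq_tmatrixRows)
open Literature.Combinatorics.Designs.OrthogonalDesigns (IsOD IsBHArray IsWilliamsonType plugIn plugIn_isHadamard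
  IsBHArray.isOD IsOD.subst_mul_transpose)

/-! ## §1 The entry table of the Goethals–Seidel array -/

section Table

variable {G : Type*} [AddCommGroup G]

/-- the "xor" table on `Fin 4` (`p ⊕ q` in binary): it records WHICH first row occupies block `(p, q)` of the
Goethals–Seidel array (`A B C D / B A D C / C D A B / D C B A`), and equally which variable multiplies `X_k` in row `p` of
the Cooper–Wallis substitution (`A = aX₁+bX₂+cX₃+dX₄`, `B = -bX₁+aX₂+dX₃-cX₄`, …). [cite: SeberryYamada2020, Theorem 3.11 (Cooper–J. Wallis)] -/
def xor4 : Fin 4 → Fin 4 → Fin 4 := ![![0, 1, 2, 3], ![1, 0, 3, 2], ![2, 3, 0, 1], ![3, 2, 1, 0]]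

/-- `xor4 p` is an involution: `p ⊕ (p ⊕ k) = k`. [cite: SeberryYamada2020, Theorem 3.11 (Cooper–J. Wallis)] -/
lemma xor4_xor4 (p k : Fin 4) : xor4 p (xor4 p k) = k := by
  fin_cases p <;> fin_cases k <;> rfl

/-- `xor4 p` is injective. [cite: SeberryYamada2020, Theorem 3.11 (Cooper–J. Wallis)] -/
lemma xor4_injective (p : Fin 4) : Function.Injective (xor4 p) := fun k l h => by
  rw [← xor4_xor4 p k, ← xor4_xor4 p l, h]

/-- the block KIND of the Goethals–Seidel array: `0` = circulant (diagonal blocks, entry `x (i - j)`), `1` = `X R`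
(back-circulant, first block row and column, entry `x (i + j)`), `2` = `Xᵀ R` (entry `x (-(i + j))`).
[cite: GoethalsSeidel1970, the array] -/
def gsKind : Fin 4 → Fin 4 → Fin 3 := ![![0, 1, 1, 1], ![1, 0, 2, 2], ![1, 2, 0, 2], ![1, 2, 2, 0]]

/-- the argument at which block `(p, q)` of the Goethals–Seidel array reads its first row, at position `(i, j)`.
[cite: GoethalsSeidel1970, the array] -/
def gsArg (p q : Fin 4) (i j : G) : G := ![i - j, i + j, -(i + j)] (gsKind p q)

/-- **entry table of the Goethals–Seidel array**: block `(p, q)` at position `(i, j)` holds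
`ε_{pq} · a_{p ⊕ q} (gsArg p q i j)` with the sign pattern `ε = cwSign` (`+ + + + / - + + - / - - + + / - + - +`).
In particular the array is linear in its four first rows and each entry is `±` a single row entry.
[cite: GoethalsSeidel1970, the array] -/
theorem gsMatrix_apply_table (a : Fin 4 → G → ℤ) (p q : Fin 4) (i j : G) :
    gsMatrix (a 0) (a 1) (a 2) (a 3) (p, i) (q, j) = cwSign p q * a (xor4 p q) (gsArg p q i j) := by
  fin_cases p <;> fin_cases q <;>
    simp [gsMatrix, gsBlocks, cwSign, xor4, gsArg, gsKind, circulant_apply, bcirc_apply, bcircT_apply]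

end Table

/-! ## §2 The Cooper–Wallis rows with weights and their Gram identity -/

section Rows

variable {n : ℕ} [NeZero n]

/-- the Cooper–Wallis rows with integer weights `x = (a, b, c, d)`: `R_p = Σ_k ε_{pk} x_{p ⊕ k} t_k`, i.e. the first rows
of `A = aX₁+bX₂+cX₃+dX₄`, `B = -bX₁+aX₂+dX₃-cX₄`, `C = -cX₁-dX₂+aX₃+bX₄`, `D = -dX₁+cX₂-bX₃+aX₄`.
[cite: SeberryYamada2020, Theorem 3.11 (Cooper–J. Wallis)] -/
def cwRowX (t : Fin 4 → ZMod n → ℤ) (x : Fin 4 → ℤ) (p : Fin 4) : ZMod n → ℤ :=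
  fun i => ∑ k, cwSign p k * x (xor4 p k) * t k i

omit [NeZero n] in
/-- at `a = b = c = d = 1` these are the rows of `TMatrixRows.cwRowZ`. [cite: SeberryYamada2020, Theorem 3.11 (Cooper–J. Wallis)] -/
lemma cwRowX_one (t : Fin 4 → ZMod n → ℤ) : cwRowX t (fun _ => 1) = cwRowZ t := by
  funext p i
  simp [cwRowX, cwRowZ]

omit [NeZero n] in
/-- **orthogonality of the substitution pattern** (`OD(4; 1, 1, 1, 1)`): pointwise,
`Σ_p R_p(i) R_p(j) = (a² + b² + c² + d²) Σ_k t_k(i) t_k(j)` — the cross terms `X_k X_lᵀ`, `k ≠ l`, cancel.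
[cite: SeberryYamada2020, Theorem 3.11 (Cooper–J. Wallis)] -/
lemma sum_cwRowX_mul (t : Fin 4 → ZMod n → ℤ) (x : Fin 4 → ℤ) (i j : ZMod n) :
    ∑ p, cwRowX t x p i * cwRowX t x p j = (∑ v, x v ^ 2) * ∑ k, t k i * t k j := by
  simp [cwRowX, cwSign, xor4, Fin.sum_univ_four]
  ring

/-- hence `Σ_p PAF_{R_p}(s) = (a² + b² + c² + d²) Σ_k PAF_{t_k}(s)`. [cite: SeberryYamada2020, Theorem 3.11 (Cooper–J. Wallis)] -/
lemma sum_paf_cwRowX (t : Fin 4 → ZMod n → ℤ) (x : Fin 4 → ℤ) (s : ZMod n) :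
    ∑ p, PAF (cwRowX t x p) s = (∑ v, x v ^ 2) * ∑ k, PAF (t k) s := by
  simp only [PAF]
  calc ∑ p, ∑ i, cwRowX t x p i * cwRowX t x p (i + s)
      = ∑ i, ∑ p, cwRowX t x p i * cwRowX t x p (i + s) := Finset.sum_comm
    _ = ∑ i, (∑ v, x v ^ 2) * ∑ k, t k i * t k (i + s) := by simp_rw [sum_cwRowX_mul]
    _ = (∑ v, x v ^ 2) * ∑ i, ∑ k, t k i * t k (i + s) := by rw [Finset.mul_sum]
    _ = (∑ v, x v ^ 2) * ∑ k, ∑ i, t k i * t k (i + s) := by rw [Finset.sum_comm]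

/-- for first rows of T-matrices, `Σ_k PAF_{t_k}(0) = n` (one `±1` per position: `Σ Tᵢ Tᵢᵀ` has diagonal `n`).
[cite: SeberryYamada2020, Definition 1.59] -/
lemma sum_paf_zero_of_tmatrixRows {t : Fin 4 → ZMod n → ℤ}
    (h1 : ∀ i, ∃ k, (t k i = 1 ∨ t k i = -1) ∧ ∀ k', k' ≠ k → t k' i = 0) : ∑ k, PAF (t k) 0 = n := by
  simp only [PAF, add_zero]
  rw [Finset.sum_comm]
  have : ∀ i, ∑ k, t k i * t k i = 1 := fun i => by
    obtain ⟨k, hk, h0⟩ := h1 i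
    rw [Finset.sum_eq_single k (fun k' _ hk' => by rw [h0 k' hk', mul_zero]) fun hk' => absurd (mem_univ k) hk']
    rcases hk with e | e <;> rw [e] <;> norm_num
  simp [this]

/-- **Gram identity**: for first rows `t` of T-matrices of order `n` and integer weights `x`,
`Σ_p R_p R_pᵀ = (a² + b² + c² + d²) n I` (as circulants). [cite: SeberryYamada2020, Theorem 3.11 (Cooper–J. Wallis)] -/
theorem gram_cwRowX {t : Fin 4 → ZMod n → ℤ} (ht : IsTMatrixRows n t) (x : Fin 4 → ℤ) :
    Literature.Combinatorics.Designs.GoethalsSeidel.gram (cwRowX t x 0) (cwRowX t x 1) (cwRowX t x 2)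
        (cwRowX t x 3) = ((∑ v, x v ^ 2) * n : ℤ) • (1 : Matrix (ZMod n) (ZMod n) ℤ) := by
  ext i k
  rw [Literature.Combinatorics.Designs.GoethalsSeidel.gram, Matrix.add_apply, Matrix.add_apply, Matrix.add_apply,
    circulant_mul_circT_apply, circulant_mul_circT_apply, circulant_mul_circT_apply, circulant_mul_circT_apply,
    Matrix.smul_apply, Matrix.one_apply, smul_eq_mul]
  have h := sum_paf_cwRowX t x (k - i)
  simp only [Fin.sum_univ_four] at h
  rw [show PAF (cwRowX t x 0) (k - i) + PAF (cwRowX t x 1) (k - i) + PAF (cwRowX t x 2) (k - i) +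
      PAF (cwRowX t x 3) (k - i) = (x 0 ^ 2 + x 1 ^ 2 + x 2 ^ 2 + x 3 ^ 2) *
      (PAF (t 0) (k - i) + PAF (t 1) (k - i) + PAF (t 2) (k - i) + PAF (t 3) (k - i)) from h]
  by_cases hik : i = k
  · subst hik
    have h0 := sum_paf_zero_of_tmatrixRows ht.1
    simp only [Fin.sum_univ_four] at h0
    rw [sub_self, h0, if_pos rfl, mul_one, Fin.sum_univ_four]
  · have hki : k - i ≠ 0 := sub_ne_zero.mpr (Ne.symm hik)
    have h0 := ht.2 _ hki
    simp only [Fin.sum_univ_four] at h0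
    rw [h0, if_neg hik, mul_zero, mul_zero]

/-- the Goethals–Seidel array on the weighted Cooper–Wallis rows: `M(x)`, the design `OD(4n; n,n,n,n)` with the integer
values `x = (a, b, c, d)` substituted. [cite: SeberryYamada2020, Theorem 3.11 (Cooper–J. Wallis)] -/
def cwMatrixX (t : Fin 4 → ZMod n → ℤ) (x : Fin 4 → ℤ) : Matrix (Fin 4 × ZMod n) (Fin 4 × ZMod n) ℤ :=
  gsMatrix (cwRowX t x 0) (cwRowX t x 1) (cwRowX t x 2) (cwRowX t x 3)

/-- **Theorem 3.11 for every integer substitution**: `M(x) M(x)ᵀ = (a² + b² + c² + d²) n I`.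
[cite: SeberryYamada2020, Theorem 3.11 (Cooper–J. Wallis)] -/
theorem cwMatrixX_mul_transpose {t : Fin 4 → ZMod n → ℤ} (ht : IsTMatrixRows n t) (x : Fin 4 → ℤ) :
    cwMatrixX t x * (cwMatrixX t x)ᵀ = ((∑ v, x v ^ 2) * n : ℤ) • (1 : Matrix (Fin 4 × ZMod n) (Fin 4 × ZMod n) ℤ) :=
  gsMatrix_mul_transpose _ _ _ _ _ (gram_cwRowX ht x)

end Rows

/-! ## §3 The coefficient matrices: a Baumert–Hall array of order `n` -/

section Coefficients

variable {n : ℕ} [NeZero n]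

/-- the coefficient matrix of the variable `x_v` in the Cooper–Wallis design: `P_v = M(e_v)`.
[cite: SeberryYamada2020, Theorem 3.11 (Cooper–J. Wallis)] -/
def cwCoef (t : Fin 4 → ZMod n → ℤ) (v : Fin 4) : Matrix (Fin 4 × ZMod n) (Fin 4 × ZMod n) ℤ :=
  cwMatrixX t (Pi.single v 1)

omit [NeZero n] in
/-- entries of `M(x)` from the table: block `(p, q)`, position `(i, j)` holds
`ε_{pq} Σ_k ε_{p'k} x_{p' ⊕ k} t_k(g)` with `p' = p ⊕ q`, `g = gsArg p q i j`. [cite: SeberryYamada2020, Theorem 3.11 (Cooper–J. Wallis)] -/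
lemma cwMatrixX_apply (t : Fin 4 → ZMod n → ℤ) (x : Fin 4 → ℤ) (p q : Fin 4) (i j : ZMod n) :
    cwMatrixX t x (p, i) (q, j) =
      cwSign p q * ∑ k, cwSign (xor4 p q) k * x (xor4 (xor4 p q) k) * t k (gsArg p q i j) := by
  rw [cwMatrixX, show gsMatrix (cwRowX t x 0) (cwRowX t x 1) (cwRowX t x 2) (cwRowX t x 3) =
      gsMatrix (cwRowX t x 0) (cwRowX t x 1) (cwRowX t x 2) (cwRowX t x 3) from rfl,
    gsMatrix_apply_table (cwRowX t x)]
  rfl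

omit [NeZero n] in
/-- entries of the coefficient matrix `P_v`: `ε_{pq} ε_{p', p' ⊕ v} · t_{p' ⊕ v}(g)` — a single T-matrix row entry with a
sign. [cite: SeberryYamada2020, Theorem 3.11 (Cooper–J. Wallis)] -/
lemma cwCoef_apply (t : Fin 4 → ZMod n → ℤ) (v p q : Fin 4) (i j : ZMod n) :
    cwCoef t v (p, i) (q, j) =
      cwSign p q * cwSign (xor4 p q) (xor4 (xor4 p q) v) * t (xor4 (xor4 p q) v) (gsArg p q i j) := by
  rw [cwCoef, cwMatrixX_apply, mul_assoc]
  congr 1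
  rw [Finset.sum_eq_single (xor4 (xor4 p q) v)]
  · rw [xor4_xor4, Pi.single_eq_same, mul_one]
  · intro k _ hk
    have : xor4 (xor4 p q) k ≠ v := fun h => hk (by rw [← h, xor4_xor4])
    rw [Pi.single_eq_of_ne this, mul_zero, zero_mul]
  · intro h
    exact absurd (mem_univ _) h

omit [NeZero n] in
/-- **linearity**: `M(x) = Σ_v x_v P_v`. [cite: SeberryYamada2020, Theorem 3.11 (Cooper–J. Wallis)] -/
theorem cwMatrixX_eq_sum (t : Fin 4 → ZMod n → ℤ) (x : Fin 4 → ℤ) : cwMatrixX t x = ∑ v, x v • cwCoef t v := by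
  ext ⟨p, i⟩ ⟨q, j⟩
  rw [cwMatrixX_apply, Matrix.sum_apply]
  simp only [Matrix.smul_apply, cwCoef_apply, smul_eq_mul, Finset.mul_sum]
  -- reindex the sum over `k` by `k = p' ⊕ v`
  refine Fintype.sum_equiv (Equiv.ofBijective (xor4 (xor4 p q))
    ⟨xor4_injective _, fun k => ⟨xor4 (xor4 p q) k, xor4_xor4 _ _⟩⟩) _ _ fun k => ?_
  simp only [Equiv.ofBijective_apply, xor4_xor4]
  ring

/-- **Cooper–Wallis: T-matrices give a Baumert–Hall array** (`OD(4n; n, n, n, n)`): the four coefficient matrices of the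
Cooper–Wallis design on first rows of T-matrices of order `n` satisfy `P_v P_vᵀ = n I`, `P_v P_wᵀ + P_w P_vᵀ = 0`
(`v ≠ w`) and have exactly one non-zero (`±1`) entry at each position; Theorem 3.10 (ii)–(iii), Corollary 3.5.
[cite: SeberryYamada2020, Corollary 3.5] -/
theorem cwCoef_isBHArray {t : Fin 4 → ZMod n → ℤ} (ht : IsTMatrixRows n t) : IsBHArray n (cwCoef t) := by
  have hsq : ∀ v : Fin 4, ∑ w, (Pi.single v (1 : ℤ) : Fin 4 → ℤ) w ^ 2 = 1 := fun v => by
    rw [Finset.sum_eq_single v (fun w _ hw => by rw [Pi.single_eq_of_ne hw]; ring)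
      fun h => absurd (mem_univ v) h, Pi.single_eq_same, one_pow]
  have hdiag : ∀ v, cwCoef t v * (cwCoef t v)ᵀ = (n : ℤ) • (1 : Matrix (Fin 4 × ZMod n) (Fin 4 × ZMod n) ℤ) :=
    fun v => by rw [cwCoef, cwMatrixX_mul_transpose ht, hsq, one_mul]
  refine ⟨by simp [Fintype.card_prod, ZMod.card], fun a b => ?_, hdiag, fun v w hvw => ?_⟩
  · -- one non-zero per position
    obtain ⟨p, i⟩ := a
    obtain ⟨q, j⟩ := b
    obtain ⟨k₀, hk₀, h0⟩ := ht.1 (gsArg p q i j)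
    refine ⟨xor4 (xor4 p q) k₀, ?_, fun v hv => ?_⟩
    · rw [cwCoef_apply, xor4_xor4]
      rcases cwSign_pm p q with e₁ | e₁ <;> rcases cwSign_pm (xor4 p q) k₀ with e₂ | e₂ <;>
        rcases hk₀ with e₃ | e₃ <;> simp [e₁, e₂, e₃]
    · rw [cwCoef_apply]
      have hk : xor4 (xor4 p q) v ≠ k₀ := fun h => hv (by rw [← h, xor4_xor4])
      rw [h0 _ hk, mul_zero]
  · -- polarisation: `M(e_v + e_w) = P_v + P_w` has Gram matrix `2n I`
    have hadd : cwMatrixX t (Pi.single v 1 + Pi.single w 1) = cwCoef t v + cwCoef t w := by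
      rw [cwMatrixX_eq_sum, cwCoef, cwCoef, cwMatrixX_eq_sum, cwMatrixX_eq_sum, ← Finset.sum_add_distrib]
      exact Finset.sum_congr rfl fun u _ => by rw [Pi.add_apply, add_smul]
    have hsq2 : ∑ u, (Pi.single v (1 : ℤ) + Pi.single w 1 : Fin 4 → ℤ) u ^ 2 = 2 := by
      have hvw' : ∀ u, (Pi.single v (1 : ℤ) + Pi.single w 1 : Fin 4 → ℤ) u ^ 2 =
          (Pi.single v (1 : ℤ) : Fin 4 → ℤ) u ^ 2 + (Pi.single w (1 : ℤ) : Fin 4 → ℤ) u ^ 2 := by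
        intro u
        rw [Pi.add_apply]
        by_cases hu : u = v
        · subst hu; rw [Pi.single_eq_same, Pi.single_eq_of_ne hvw]; ring
        · rw [Pi.single_eq_of_ne hu]; ring
      simp_rw [hvw', Finset.sum_add_distrib, hsq]
      norm_num
    have h2 := cwMatrixX_mul_transpose ht (Pi.single v 1 + Pi.single w 1)
    rw [hadd, hsq2, Matrix.transpose_add, Matrix.add_mul, Matrix.mul_add, Matrix.mul_add, hdiag v, hdiag w] at h2
    -- `n + (P_v P_wᵀ + P_w P_vᵀ) + n = 2n`
    calc cwCoef t v * (cwCoef t w)ᵀ + cwCoef t w * (cwCoef t v)ᵀ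
        = ((n : ℤ) • 1 + cwCoef t v * (cwCoef t w)ᵀ + (cwCoef t w * (cwCoef t v)ᵀ + (n : ℤ) • 1)) -
            (n : ℤ) • 1 - (n : ℤ) • (1 : Matrix (Fin 4 × ZMod n) (Fin 4 × ZMod n) ℤ) := by abel
      _ = 0 := by rw [h2, two_mul, add_smul]; abel

/-- the Cooper–Wallis coefficient matrices form an `OD(4n; n, n, n, n)`. [cite: SeberryYamada2020, Theorem 3.11 (Cooper–J. Wallis)] -/
theorem cwCoef_isOD {t : Fin 4 → ZMod n → ℤ} (ht : IsTMatrixRows n t) : IsOD (cwCoef t) fun _ => n :=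
  (cwCoef_isBHArray ht).isOD

/-- **Theorem 3.11 as printed** ("let `a, b, c, d` be commuting variables"): for `a, b, c, d` in ANY commutative ring,
the Goethals–Seidel array `D = a P₀ + b P₁ + c P₂ + d P₃` on T-matrices of order `n` satisfies
`D Dᵀ = (a² + b² + c² + d²) n I`. [cite: SeberryYamada2020, Theorem 3.11 (Cooper–J. Wallis)] -/
theorem cwDesign_mul_transpose {t : Fin 4 → ZMod n → ℤ} (ht : IsTMatrixRows n t) {α : Type*} [CommRing α]
    (x : Fin 4 → α) :
    (∑ v, x v • (cwCoef t v).map (Int.cast : ℤ → α)) * (∑ v, x v • (cwCoef t v).map (Int.cast : ℤ → α))ᵀ =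
      ((n : α) * ∑ v, x v ^ 2) • (1 : Matrix (Fin 4 × ZMod n) (Fin 4 × ZMod n) α) := by
  rw [(cwCoef_isOD ht).subst_mul_transpose x, ← Finset.mul_sum]

end Coefficients

/-! ## §4 Corollary 3.6: T-matrices of order `n` and Williamson-type matrices of order `w` give `H(4nw)` -/

section PlugIn

variable {n : ℕ} [NeZero n] {κ : Type*} [Fintype κ] [DecidableEq κ]

/-- **Corollary 3.6 (Cooper–Wallis with Williamson-type matrices).**  First rows of T-matrices of order `n` and
Williamson-type matrices `X₀, …, X₃` of order `w` give the Hadamard matrix `Σ_v P_v ⊗ X_v` of order `4nw`.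
[cite: SeberryYamada2020, Corollary 3.6] -/
theorem hadamard_of_tmatrixRows_williamsonType {t : Fin 4 → ZMod n → ℤ} (ht : IsTMatrixRows n t)
    {X : Fin 4 → Matrix κ κ ℤ} (hX : IsWilliamsonType X) : IsHadamardMatrix (plugIn (cwCoef t) X) :=
  plugIn_isHadamard (cwCoef_isBHArray ht) hX

/-- existence form of Corollary 3.6: T-matrices of order `n` and Williamson-type matrices of order `w` ⇒ a Hadamard
matrix of order `4nw`. [cite: SeberryYamada2020, Corollary 3.6] -/
theorem exists_hadamard_of_tmatrixRows_williamsonType {t : Fin 4 → ZMod n → ℤ} (ht : IsTMatrixRows n t)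
    {X : Fin 4 → Matrix κ κ ℤ} (hX : IsWilliamsonType X) :
    ∃ H : Matrix ((Fin 4 × ZMod n) × κ) ((Fin 4 × ZMod n) × κ) ℤ,
      IsHadamardMatrix H ∧ Fintype.card ((Fin 4 × ZMod n) × κ) = 4 * n * Fintype.card κ :=
  ⟨_, hadamard_of_tmatrixRows_williamsonType ht hX, by simp [Fintype.card_prod, ZMod.card]⟩

/-- T-sequence form of Corollary 3.6 (Theorem 3.10 (i): T-sequences are first rows of T-matrices): T-sequences of
length `n` and Williamson-type matrices of order `w` ⇒ a Hadamard matrix of order `4nw`. [cite: SeberryYamada2020, Corollary 3.6] -/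
theorem exists_hadamard_of_tseq_williamsonType {t : Fin 4 → ℕ → ℤ} (ht : IsTSeq n t) {X : Fin 4 → Matrix κ κ ℤ}
    (hX : IsWilliamsonType X) :
    ∃ H : Matrix ((Fin 4 × ZMod n) × κ) ((Fin 4 × ZMod n) × κ) ℤ,
      IsHadamardMatrix H ∧ Fintype.card ((Fin 4 × ZMod n) × κ) = 4 * n * Fintype.card κ :=
  exists_hadamard_of_tmatrixRows_williamsonType (tseq_tmatrixRows ht) hX

end PlugIn

end Literature.Combinatorics.Designs.CooperWallis
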